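import Literature.NumberTheory.QuadraticForms.LandherrHermitianMatricesDiagonalize
import Literature.NumberTheory.NumberFields.CMFieldPrescribedSigns
import HarnessLib

/-!
# Landherr's theorem in rank `n`: the binary move and the representation step

Topic `NumberTheory/QuadraticForms`; continuation of `LandherrHermitianDiagonalForms.lean` and
`LandherrHermitianMatricesDiagonalize.lean` (index bookkeeping `Landherr.splitEquiv`). Let `L` be a
CM field, `σ` its complex conjugation, `L⁺` the maximal real subfield, `N(z) = z · σ z`.

* `Landherr.binary_move` — from the rank-2 theorem `hermitianPlanes_isometric_of_invariants`
  (Landherr for planes, via Hasse–Minkowski over `L⁺`): if `c ∈ L⁺ˣ` has, at every complex embedding where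
  `b₁, b₂` have the same sign, that common sign, then `⟨b₁, b₂⟩ ≅ ⟨b₁b₂/c, c⟩`;
* `Landherr.RepCompat b c` — `c` carries the sign of the diagonal form `b` at every embedding where `b` is
  definite;
* `Landherr.rep_step` — **representation with a diagonal complement**: a non-degenerate diagonal hermitian
  form `b` of rank `n + 2` and a compatible `c ∈ L⁺ˣ` admit a diagonal `d` of rank `n + 1` with
  `diag b ≅ diag d ⊥ ⟨c⟩`. Induction on `n`; each step is one binary move after choosing an intermediate
  value `c' ∈ L⁺` with signs prescribed place by place
  (`Literature.NumberTheory.NumberFields.exists_isReal_signs`, Dirichlet units).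

Provenance: `pub-hodgecm` package file `Proofs/LandherrRankN.lean` §3–§4 (gen 7), ported to Mathlib vocabulary.

## References

* W. Landherr, Abh. Math. Sem. Univ. Hamburg 11 (1936) 245–248 [Landherr1936HermitianForms].
* W. Scharlau, *Quadratic and Hermitian Forms*, Grundlehren 270 (1985), Ch. 10 [Scharlau1985HermitianForms].
-/

noncomputable section

open NumberField
open scoped Matrix ComplexConjugate

namespace Literature.NumberTheory.QuadraticForms

namespace Landherr

variable (L : Type) [Field L] [NumberField L] [IsCMField L]

/-! ## §3. Real signs of `σ`-fixed elements; the binary move from the rank-2 theorem -/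

section Binary

variable {L}

/-- `Re τ(xy) = Re τ(x) · Re τ(y)` for `σ`-fixed `x`. [folklore] -/
theorem re_mul_of_isReal {x : L} (hx : IsCMField.complexConj L x = x) (y : L) (τ : L →+* ℂ) :
    (τ (x * y)).re = (τ x).re * (τ y).re := by
  rw [map_mul, embedding_eq_re hx τ, Complex.re_ofReal_mul]
  simp

/-- `Re τ(x⁻¹) = (Re τ x)⁻¹` for `σ`-fixed `x`. [folklore] -/
theorem re_inv_of_isReal {x : L} (hx : IsCMField.complexConj L x = x) (τ : L →+* ℂ) :
    (τ x⁻¹).re = ((τ x).re)⁻¹ := by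
  rw [map_inv₀, embedding_eq_re hx τ, ← Complex.ofReal_inv, Complex.ofReal_re]
  simp

/-- A non-zero `σ`-fixed element has non-zero real part at every complex embedding. [folklore] -/
theorem re_ne_zero_of_isReal {x : L} (hx : IsCMField.complexConj L x = x) (h0 : x ≠ 0) (τ : L →+* ℂ) :
    (τ x).re ≠ 0 := by
  intro h
  have e := embedding_eq_re hx τ
  rw [h, Complex.ofReal_zero, map_eq_zero] at e
  exact h0 e

omit [NumberField L] [IsCMField L] in
/-- The real part at the embedding attached to the place of `τ` is the real part at `τ`. [folklore] -/
theorem re_embedding_mk (τ : L →+* ℂ) (x : L) :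
    ((NumberField.InfinitePlace.mk τ).embedding x).re = (τ x).re := by
  rcases NumberField.InfinitePlace.embedding_mk_eq τ with h | h
  · rw [h]
  · rw [h, NumberField.ComplexEmbedding.conjugate_coe_eq, Complex.conj_re]

/-- Sign of `xy/z` for non-zero reals. [folklore] -/
theorem pos_mul_div_iff {x y z : ℝ} (hx : x ≠ 0) (hy : y ≠ 0) (hz : z ≠ 0) :
    (0 < x * y / z) ↔ ((0 < x ↔ 0 < y) ↔ 0 < z) := by
  rcases lt_or_gt_of_ne hx with hx | hx <;> rcases lt_or_gt_of_ne hy with hy | hy <;>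
    rcases lt_or_gt_of_ne hz with hz | hz
  · have h : ¬ 0 < x * y / z :=
      not_lt.mpr (le_of_lt (div_neg_of_pos_of_neg (mul_pos_of_neg_of_neg hx hy) hz))
    simp [h, not_lt.mpr (le_of_lt hx), not_lt.mpr (le_of_lt hy), not_lt.mpr (le_of_lt hz)]
  · have h : 0 < x * y / z := div_pos (mul_pos_of_neg_of_neg hx hy) hz
    simp [h, not_lt.mpr (le_of_lt hx), not_lt.mpr (le_of_lt hy), hz]
  · have h : 0 < x * y / z := div_pos_of_neg_of_neg (mul_neg_of_neg_of_pos hx hy) hz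
    simp [h, not_lt.mpr (le_of_lt hx), hy, not_lt.mpr (le_of_lt hz)]
  · have h : ¬ 0 < x * y / z :=
      not_lt.mpr (le_of_lt (div_neg_of_neg_of_pos (mul_neg_of_neg_of_pos hx hy) hz))
    simp [h, not_lt.mpr (le_of_lt hx), hy, hz]
  · have h : 0 < x * y / z := div_pos_of_neg_of_neg (mul_neg_of_pos_of_neg hx hy) hz
    simp [h, hx, not_lt.mpr (le_of_lt hy), not_lt.mpr (le_of_lt hz)]
  · have h : ¬ 0 < x * y / z :=
      not_lt.mpr (le_of_lt (div_neg_of_neg_of_pos (mul_neg_of_pos_of_neg hx hy) hz))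
    simp [h, hx, not_lt.mpr (le_of_lt hy), hz]
  · have h : ¬ 0 < x * y / z := not_lt.mpr (le_of_lt (div_neg_of_pos_of_neg (mul_pos hx hy) hz))
    simp [h, hx, hy, not_lt.mpr (le_of_lt hz)]
  · have h : 0 < x * y / z := div_pos (mul_pos hx hy) hz
    simp [h, hx, hy, hz]

/-- The sign-multiset identity `{sgn p₁, sgn p₂} = {sgn q₁, sgn q₂}` behind the binary move. [folklore] -/
theorem multiset_pair_decide_eq {p₁ p₂ q₁ q₂ : Prop} [Decidable p₁] [Decidable p₂] [Decidable q₁]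
    [Decidable q₂] (h : q₁ ↔ ((p₁ ↔ p₂) ↔ q₂)) (hc : (p₁ ↔ p₂) → (q₂ ↔ p₁)) :
    ({decide p₁, decide p₂} : Multiset Bool) = {decide q₁, decide q₂} := by
  by_cases a : p₁ <;> by_cases b : p₂ <;> by_cases c : q₂ <;> simp_all <;> decide

/-- **The binary move** (from the rank-2 theorem `lemma33bLandherr_holds`).  If `c ∈ L₀^×` has, at every
complex embedding where `b₁, b₂` have the same sign, that common sign, then `⟨b₁, b₂⟩ ≅ ⟨b₁b₂/c, c⟩`;
in particular `⟨b₁, b₂⟩` represents `c` with a diagonal complement. [cite: Landherr1936HermitianForms] -/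
theorem binary_move {b₁ b₂ c : L} (h₁ : IsCMField.complexConj L b₁ = b₁) (h₂ : IsCMField.complexConj L b₂ = b₂)
    (hc : IsCMField.complexConj L c = c) (h₁0 : b₁ ≠ 0) (h₂0 : b₂ ≠ 0) (hc0 : c ≠ 0)
    (hcompat : ∀ τ : L →+* ℂ, ((0 < (τ b₁).re) ↔ 0 < (τ b₂).re) → ((0 < (τ c).re) ↔ 0 < (τ b₁).re)) :
    IsomDiag L ![b₁, b₂] ![b₁ * b₂ / c, c] := by
  have hq : IsCMField.complexConj L (b₁ * b₂ / c) = b₁ * b₂ / c := by rw [map_div₀, map_mul, h₁, h₂, hc]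
  have hq0 : b₁ * b₂ / c ≠ 0 := div_ne_zero (mul_ne_zero h₁0 h₂0) hc0
  have hre : ∀ τ : L →+* ℂ, (τ (b₁ * b₂ / c)).re = (τ b₁).re * (τ b₂).re / (τ c).re := by
    intro τ
    rw [div_eq_mul_inv, re_mul_of_isReal (by rw [map_mul, h₁, h₂]), re_mul_of_isReal h₁, re_inv_of_isReal hc,
      div_eq_mul_inv]
  obtain ⟨g, hg⟩ := hermitianPlanes_isometric_of_invariants L ![b₁, b₂, b₁ * b₂ / c, c]
    (by intro i; fin_cases i <;> assumption)
    (by intro i; fin_cases i <;> assumption)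
    (by
      intro τ
      show ({decide (0 < (τ b₁).re), decide (0 < (τ b₂).re)} : Multiset Bool) =
        {decide (0 < (τ (b₁ * b₂ / c)).re), decide (0 < (τ c).re)}
      refine multiset_pair_decide_eq ?_ (hcompat τ)
      rw [hre τ]
      exact pos_mul_div_iff (re_ne_zero_of_isReal h₁ h₁0 τ) (re_ne_zero_of_isReal h₂ h₂0 τ)
        (re_ne_zero_of_isReal hc hc0 τ))
    ⟨1, one_ne_zero, by
      show b₁ * b₂ = b₁ * b₂ / c * c * (1 * IsCMField.complexConj L 1)
      rw [map_one, mul_one, mul_one, div_mul_cancel₀ _ hc0]⟩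
  refine IsomDiag.of_gl g ?_
  simpa [conjTranspose] using hg

omit [Field L] [NumberField L] [IsCMField L] in
/-- `![x, y]` over `Fin 2` versus `Sum.elim` over `Fin 1 ⊕ Fin 1`. [folklore] -/
theorem vec2_comp_finSumFinEquiv (x y : L) :
    (![x, y] ∘ finSumFinEquiv : Fin 1 ⊕ Fin 1 → L) = Sum.elim (fun _ => x) (fun _ => y) := by
  ext i
  rcases i with i | i <;> · have := Subsingleton.elim i 0; subst this; rfl

/-- `IsomDiag` of `![x, y]`-indexed planes as `Fin 1 ⊕ Fin 1`-indexed orthogonal sums. [folklore] -/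
theorem IsomDiag.of_vec2 {x y x' y' : L} (h : IsomDiag L ![x, y] ![x', y']) :
    IsomDiag L (Sum.elim (fun _ : Fin 1 => x) (fun _ : Fin 1 => y))
      (Sum.elim (fun _ : Fin 1 => x') (fun _ : Fin 1 => y')) := by
  have h' := h.comp_equiv (finSumFinEquiv (m := 1) (n := 1))
  rwa [vec2_comp_finSumFinEquiv, vec2_comp_finSumFinEquiv] at h'

end Binary

/-! ## §4. The representation step: an `(n+1)`-ary diagonal form (`n ≥ 1`) represents, with a diagonal
complement, every `c ∈ L₀^×` carrying the sign of the form at each place where the form is definite -/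

section Rep

variable {L}

/-- `c` is compatible with the diagonal form `b`: at every complex embedding where all `bᵢ` are positive
(resp. all negative), so is `c`.  For forms of rank `≥ 2` this is exactly "`diag b` represents `c` at every
real place". [folklore] -/
def RepCompat {ι : Type} (b : ι → L) (c : L) : Prop :=
  ∀ τ : L →+* ℂ, ((∀ i, 0 < (τ (b i)).re) → 0 < (τ c).re) ∧ ((∀ i, ¬ 0 < (τ (b i)).re) → ¬ 0 < (τ c).re)

/-- **Representation with diagonal complement.**  For a non-degenerate diagonal hermitian form `b` of rank
`n + 2` (indexed by `ι ⊕ Fin 1`, `#ι = n + 1`) and a compatible `c ∈ L₀^×` there is a diagonal form `d` of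
rank `n + 1` with `diag b ≅ diag d ⊥ ⟨c⟩`.  Induction on `n`, each step one binary move after a choice of signs
by weak approximation. [cite: Landherr1936HermitianForms] -/
theorem rep_step : ∀ (n : ℕ) (ι : Type) [Fintype ι] [DecidableEq ι], Fintype.card ι = n + 1 →
    ∀ (b : ι ⊕ Fin 1 → L) (c : L), (∀ x, IsCMField.complexConj L (b x) = b x) → (∀ x, b x ≠ 0) →
    IsCMField.complexConj L c = c → c ≠ 0 → RepCompat b c →
    ∃ d : ι → L, (∀ i, IsCMField.complexConj L (d i) = d i) ∧ (∀ i, d i ≠ 0) ∧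
      IsomDiag L b (Sum.elim d fun _ => c) := by
  intro n
  induction n with
  | zero =>
    intro ι _ _ hcard b c hb hb0 hc hc0 hcompat
    obtain ⟨i₀, hi₀⟩ := Fintype.card_eq_one_iff.mp hcard
    -- the binary move on `(b (inl i₀), b (inr 0))`
    have hbin := binary_move (hb (Sum.inl i₀)) (hb (Sum.inr 0)) hc (hb0 _) (hb0 _) hc0 (by
      intro τ hiff
      obtain ⟨hpos, hneg⟩ := hcompat τ
      by_cases h0 : 0 < (τ (b (Sum.inl i₀))).re
      · refine iff_of_true (hpos ?_) h0
        rintro (i | j)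
        · rw [hi₀ i]; exact h0
        · rw [Subsingleton.elim j 0]; exact hiff.mp h0
      · refine iff_of_false (hneg ?_) h0
        rintro (i | j)
        · rw [hi₀ i]; exact h0
        · rw [Subsingleton.elim j 0]; exact fun h => h0 (hiff.mpr h))
    have h2 := (IsomDiag.of_vec2 hbin).comp_equiv
      (Equiv.sumCongr (Fintype.equivFinOfCardEq hcard) (Equiv.refl (Fin 1)))
    refine ⟨fun _ => b (Sum.inl i₀) * b (Sum.inr 0) / c, fun _ => by rw [map_div₀, map_mul, hb, hb, hc],
      fun _ => div_ne_zero (mul_ne_zero (hb0 _) (hb0 _)) hc0, ?_⟩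
    convert h2 using 1
    · ext x
      rcases x with i | j
      · simp [hi₀ i]
      · simp [Subsingleton.elim j 0]
    · ext x
      rcases x with i | j <;> simp
  | succ n ih =>
    intro ι _ _ hcard b c hb hb0 hc hc0 hcompat
    classical
    obtain ⟨i₀⟩ : Nonempty ι := Fintype.card_pos_iff.mp (by omega)
    -- split off `i₀`:  `ι ≃ {i // i ≠ i₀} ⊕ Fin 1`
    have hκ : Fintype.card {i // i ≠ i₀} = n + 1 := by rw [card_ne, hcard]; omega
    let eκ : {i // i ≠ i₀} ⊕ Fin 1 ≃ ι := splitEquiv i₀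
    let b' : {i // i ≠ i₀} ⊕ Fin 1 → L := fun x => b (Sum.inl (eκ x))
    let bu : L := b (Sum.inr 0)
    -- choice of the intermediate value `c'` by weak approximation (signs prescribed place by place)
    let sgnR : (L → ℝ) → Bool := fun ρ =>
      if (∀ i : ι, 0 < ρ (b (Sum.inl i)) ↔ 0 < ρ (b (Sum.inl i₀))) then decide (0 < ρ (b (Sum.inl i₀)))
      else decide (0 < ρ c)
    obtain ⟨c', hc', hc'sgn⟩ :=
      Literature.NumberTheory.NumberFields.exists_isReal_signs L (fun w => sgnR fun x => (w.embedding x).re)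
    have hτc' : ∀ τ : L →+* ℂ, (τ c').re ≠ 0 ∧ ((0 < (τ c').re) ↔ sgnR (fun x => (τ x).re) = true) := by
      intro τ
      obtain ⟨r, hr, hr0, hiff⟩ := hc'sgn τ
      have hfun : (fun x => ((NumberField.InfinitePlace.mk τ).embedding x).re) = fun x => (τ x).re :=
        funext (re_embedding_mk τ)
      rw [hfun] at hiff
      rw [hr, Complex.ofReal_re]
      exact ⟨hr0, hiff⟩
    obtain ⟨τ₀⟩ : Nonempty (L →+* ℂ) := inferInstance
    have hc'0 : c' ≠ 0 := by
      intro h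
      apply (hτc' τ₀).1
      rw [h, map_zero, Complex.zero_re]
    -- unfold the sign prescription
    have hsgn : ∀ τ : L →+* ℂ,
        ((∀ i : ι, 0 < (τ (b (Sum.inl i))).re ↔ 0 < (τ (b (Sum.inl i₀))).re) →
          ((0 < (τ c').re) ↔ 0 < (τ (b (Sum.inl i₀))).re)) ∧
        (¬ (∀ i : ι, 0 < (τ (b (Sum.inl i))).re ↔ 0 < (τ (b (Sum.inl i₀))).re) →
          ((0 < (τ c').re) ↔ 0 < (τ c).re)) := by
      intro τ
      have h := (hτc' τ).2
      constructor
      · intro hall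
        rw [h]
        simp only [sgnR, if_pos hall, decide_eq_true_eq]
      · intro hnall
        rw [h]
        simp only [sgnR, if_neg hnall, decide_eq_true_eq]
    -- `c'` is compatible with `b'` (whose entries are the `b (inl i)`, `i : ι`)
    have hcompat' : RepCompat b' c' := by
      intro τ
      constructor
      · intro hall
        have hall' : ∀ i : ι, 0 < (τ (b (Sum.inl i))).re := fun i => by
          simpa [b'] using hall (eκ.symm i)
        have hiff : ∀ i : ι, 0 < (τ (b (Sum.inl i))).re ↔ 0 < (τ (b (Sum.inl i₀))).re :=
          fun i => iff_of_true (hall' i) (hall' i₀)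
        exact ((hsgn τ).1 hiff).mpr (hall' i₀)
      · intro hall
        have hall' : ∀ i : ι, ¬ 0 < (τ (b (Sum.inl i))).re := fun i => by
          simpa [b'] using hall (eκ.symm i)
        have hiff : ∀ i : ι, 0 < (τ (b (Sum.inl i))).re ↔ 0 < (τ (b (Sum.inl i₀))).re :=
          fun i => iff_of_false (hall' i) (hall' i₀)
        exact fun h => hall' i₀ (((hsgn τ).1 hiff).mp h)
    -- induction hypothesis on `κ`
    obtain ⟨d', hd', hd'0, hIH⟩ :=
      ih {i // i ≠ i₀} hκ b' c' (fun x => hb _) (fun x => hb0 _) hc' hc'0 hcompat'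
    -- the binary move on `(c', bu)` with value `c`
    have hbin := binary_move hc' (hb (Sum.inr 0)) hc hc'0 (hb0 (Sum.inr 0)) hc0 (by
      intro τ hiff
      obtain ⟨hpos, hneg⟩ := hcompat τ
      by_cases hall : ∀ i : ι, 0 < (τ (b (Sum.inl i))).re ↔ 0 < (τ (b (Sum.inl i₀))).re
      · have e1 := (hsgn τ).1 hall
        by_cases h0 : 0 < (τ (b (Sum.inl i₀))).re
        · have hc'pos : 0 < (τ c').re := e1.mpr h0
          refine iff_of_true (hpos ?_) hc'pos
          rintro (i | j)
          · exact (hall i).mpr h0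
          · rw [Subsingleton.elim j 0]; exact hiff.mp hc'pos
        · have hc'neg : ¬ 0 < (τ c').re := fun h => h0 (e1.mp h)
          refine iff_of_false (hneg ?_) hc'neg
          rintro (i | j)
          · exact fun h => h0 ((hall i).mp h)
          · rw [Subsingleton.elim j 0]; exact fun h => hc'neg (hiff.mpr h)
      · exact ((hsgn τ).2 hall).symm)
    -- assemble:  b ∘ E₂ = b' ⊥ ⟨bu⟩ ≅ (d' ⊥ ⟨c'⟩) ⊥ ⟨bu⟩ ≅ d' ⊥ ⟨c'bu/c⟩ ⊥ ⟨c⟩ = (d ⊥ ⟨c⟩) ∘ E₂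
    set q : L := c' * bu / c with hq
    have h1 : IsomDiag L (Sum.elim b' fun _ : Fin 1 => bu)
        (Sum.elim (Sum.elim d' fun _ : Fin 1 => c') fun _ : Fin 1 => bu) :=
      hIH.sum (IsomDiag.refl L _)
    have h2 := ((IsomDiag.refl L d').sum (IsomDiag.of_vec2 hbin)).comp_equiv
      (Equiv.sumAssoc {i // i ≠ i₀} (Fin 1) (Fin 1))
    have e2a : (Sum.elim d' (Sum.elim (fun _ : Fin 1 => c') fun _ : Fin 1 => bu)) ∘
        Equiv.sumAssoc {i // i ≠ i₀} (Fin 1) (Fin 1)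
        = Sum.elim (Sum.elim d' fun _ : Fin 1 => c') fun _ : Fin 1 => bu := by
      ext x; rcases x with (k | j) | j <;> simp
    have e2b : (Sum.elim d' (Sum.elim (fun _ : Fin 1 => c' * bu / c) fun _ : Fin 1 => c)) ∘
        Equiv.sumAssoc {i // i ≠ i₀} (Fin 1) (Fin 1)
        = Sum.elim (Sum.elim d' fun _ : Fin 1 => q) fun _ : Fin 1 => c := by
      ext x; rcases x with (k | j) | j <;> simp [hq]
    rw [e2a, e2b] at h2
    have h3 := h1.trans h2
    -- push forward along `E₂ : (κ ⊕ Fin 1) ⊕ Fin 1 ≃ ι ⊕ Fin 1`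
    let E₂ : ({i // i ≠ i₀} ⊕ Fin 1) ⊕ Fin 1 ≃ ι ⊕ Fin 1 := Equiv.sumCongr eκ (Equiv.refl (Fin 1))
    let d : ι → L := fun i => if h : i = i₀ then q else d' ⟨i, h⟩
    refine ⟨d, fun i => ?_, fun i => ?_, IsomDiag.of_comp_equiv E₂ ?_⟩
    · by_cases h : i = i₀
      · simp only [d, dif_pos h, hq]; rw [map_div₀, map_mul, hc', hb, hc]
      · simp only [d, dif_neg h]; exact hd' _
    · by_cases h : i = i₀
      · simp only [d, dif_pos h, hq]; exact div_ne_zero (mul_ne_zero hc'0 (hb0 _)) hc0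
      · simp only [d, dif_neg h]; exact hd'0 _
    · convert h3 using 1
      · ext x
        rcases x with (k | j) | j
        · simp [E₂, b', eκ]
        · simp [E₂, b', eκ]
        · obtain rfl : j = 0 := Subsingleton.elim _ _
          simp [E₂, bu]
      · ext x
        rcases x with (⟨k, hk⟩ | j) | j
        · simp [E₂, d, eκ, hk]
        · simp [E₂, d, eκ]
        · simp [E₂]

end Rep

end Landherr

end Literature.NumberTheory.QuadraticForms

end
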